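import Literature.MathematicalPhysics.QuantumFieldTheory.Balaban1983to89.B6Prop26PairKLevelAssemblyV1
import Literature.MathematicalPhysics.QuantumFieldTheory.Balaban1983to89.B6GradLegKLevelV1
import Literature.MathematicalPhysics.QuantumFieldTheory.Balaban1983to89.B6Prop26KLevelAssemblyPadV1
import Literature.MathematicalPhysics.QuantumFieldTheory.Balaban1983to89.B6Line3CubeV1

/-!
# `Balaban1983to89.B6Prop26GradKLevelV1` — T. Bałaban, *Propagators and renormalization transformations for lattice gauge theories. II*,
# Commun. Math. Phys. **96** (1984) 223–250 [Balaban1984PropagatorsII], **PROP. 2.6, ENTRY (2.136)₂ `|(∇GJ)(x)| ≤ O(1)·Lʲη·e^{−δ₃d(y,y′)}|J|`** (p. 247)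
# FOR THE GENUINE `k`-LEVEL `G = Δ_a⁻¹` ON THE V1 TORUS — together with (2.136)₁, ONLY LINE 3 DISPLAYED

statement-level skeleton of published theorems with citation tags; proofs where landed; nothing here is a claim about the Yang–Mills mass gap

PDF held: `paper:balaban1984-cmp96-propagators-rt-ii` (journal page = PDF page + 222), p. 247 [PDF 25] re-read this generation (text layer `p0025.txt`):
*"Reasoning in the same way as in the proof of Proposition 2.2 we obtain Proposition 2.6. There exists a positive constant δ₃ depending on d and L only,
such that |(GJ)(x)|, |(∇GJ)(x)|, |(G∇*J)(x)|, |(ΔGJ)(x)| ≤ O(1)[(Lʲη)², Lʲη, Lʲη, 1]e^{−δ₃d(y,y′)}|J| (2.136) for x ∈ Δ(y), y ∈ Λ_j, supp J ⊂ Δ(y′),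
with the constant O(1) depending on d and L only"*.

CITATION HEADER (lean-in-tree rule) — WHAT IS REPRODUCED.  Phase-2 file of the `lit-balaban` typed skeleton (HOME `run/shared/lean/pub/lit-balaban/`),
seat **p38 gen 30** (free target under protocol G.5-34(d), TAKING line HOME/STATUS.md 2026-08-23T13:2xZ, cc the B6 fold owner r03 and the CONSUMER r05:
`…B8Prop3MultiLevelTorusP26` ([B8] Prop. 3 at `U₀ = 1` on the `k`-level torus) takes the (2.136)₂-shape majorants of `∇G(1)` as its «slot 2» —
*«no k-level producer yet»*); SKELETON row **B6.Prop2.6** (cells only; head unchanged, owner r03).  THIS FILE = THE SLOT-2 PRODUCER: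
**`prop26_2136_grad_kLevel_line3_le`** — for the weight band `[b₀, b₁]` there is `σ₀ > 0` such that for every rate `σ ∈ (0, σ₀]`, budget `α ∈ [0, 1]`,
`N₀ ≥ 1` and line-3 constants `C_D ≥ 0`, `c_D > 0` there are `A ≥ 0`, `M₁ > 0` (on `d, L, b₀, b₁, σ, α, N₀, C_D, c_D`; uniform in `k, M_h, m, K, c′`)
such that on every admissible V1 torus (`k ≥ 2`, `M_h = Lᵃ ≥ 8`, `R ≥ 2L²`, `P′ ≥ 5`, `L ≥ 5`, cubes placed, `M₁ ≤ L·M_h`, `N₀ + 1 ≤ R·L·M_h`, the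
(2.59)-shape budget at rate `σ`), for `c′ ≠ 0` and weights in the global band, GIVEN ONLY the line-3 majorant (iv) of `ζ_□(∂(1−R)∂* − P_□)h_□` at rate
`2σ` for every cube (the r03 g22 / p22 lane): BOTH
* (2.136)₁: `HasMajorant (geomT D) (blkV1 hN D) (onFun G) (A·(L^{j(y)}/c′)²·e^{−delta3 α (2σ)·d_T})` (= p38 g29's `…PerCube.prop26_2136_kLevel_assembly_line3`
  at a parametrised rate), AND
* **(2.136)₂**: for every direction `ν`, `HasMajorant (geomT D) (blkV1 hN D) (DV ν c′ ∘ₗ onFun G) (A·((geomT D).len y·|c′|⁻¹)·e^{−delta3 α (2σ)·d_T})` —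
  r05's slot-2 shape VERBATIM with `Dop ν := DV ν c′ = c′•(S_ν − 1)` (`…B6GradLegKLevelV1.DV`, the forward difference `∇^η_ν` of fine bond functions,
  `η = |c′|⁻¹`) and THE SAME constant `A` and rate as slot 1.
Proof = p38's pair assembly `…B6Prop26PairKLevelAssemblyV1.prop26_pair_kLevel_assembly_le` (r03's assembly script on the pair skeleton) with (i) the
`□̃`-overlap `3·9^{d+1}` (p21/r03 `card_filter_mem_QbigT_le`), (ii) `B6CubeMoutV1.outLoc_Ml_hB'`, (iii) `B6CubeCoeffSizesV1.abs_cfC_le/cfC_supp/abs_c0C_le/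
c0C_supp` discharged as in `…PerCube`, and the left-factor clause fed by the per-cube first legs `…B6GradLegKLevelV1.hDG0_cube` (rate `ρ_D`; `σ₀ := min σ₀′ ρ_D`).
**`prop26_2136_grad_kLevel_pad_le_V1`** — the same for EVERY ODD `L ≥ 5`, `k ≥ 1`, `P′ ≥ 5L` WITHOUT the placement hypothesis, via p38 g29's level
padding (`…B6PadLevelV1`: `padT`, `SameOm.GE_eq`, `hasMajorant_of_pad`), line 3 stated for the cubes of the padded family — the slot-2 twin of
`…B6Prop26KLevelAssemblyPadV1.prop26_2136_kLevel_final_pad_le_V1`.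
**`prop26_2136_grad_kLevel_unconditional`** — NO DISPLAYED ANALYTIC HYPOTHESIS: the slot-2 twin of r03 g22's
`…B6Line3CubeV1.prop26_2136_kLevel_unconditional` with the SAME binders (line 3 fed by r03's **`line3_cube`**, the Lemma-2.1 exponent `N₀` chosen inside for
`α > 0`, one threshold `M₂ ≤ L·M_h`; rate `σ ≤ min(σ₀, ρ₃/2)`), conclusion (2.136)₁ ∧ (2.136)₂; and **`prop26_2136_grad_kLevel_unconditional_pad_V1`** —
the same for every odd `L ≥ 5`, `k ≥ 1`, `P′ ≥ 5L` with NO per-cube hypothesis at all (`line3_cube` fed at the padded family).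
IMPORTS BY NAME, restating nothing (`…B6Prop26PairKLevelAssemblyV1`, `…B6GradLegKLevelV1`, `…B6Prop26KLevelAssemblyPadV1`, `…B6PadLevelV1`,
`…B6Line3CubeV1`, `…B6CubeMoutV1`, `…B6CubeCoeffSizesV1`, `…B6Cover236QbigOverlapV1`); THEOREMS ONLY; standard axioms.

HONEST SCOPE / DIVERGENCES.  (1) In §1–§2 the line-3 majorant (iv) stays DISPLAYED; in §3 it is DISCHARGED by r03 g22's `line3_cube` (p366020) — the
remaining hypotheses there are print's SETTING ((2.2): `M` large, `R ≥ 2L²`; (2.16): the weight band; the V1 torus, `L ≥ 5` odd, `M_h = Lᵃ ≥ 8`; in the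
unpadded form `k ≥ 2`, `P′ ≥ 5` and the placement of the top cubes; in the padded form `k ≥ 1`, `P′ ≥ 5L`), not analytic inputs.  (2) `DV ν c′` uses the signed fine factor like `dE c′`; the prefactor `(geomT D).len y·|c′|⁻¹ = L^{j(y)}η` is print's `Lʲη` at the OUTPUT
block; the constant `A` (a max of the slot-1 constant and `2·(3·9^{d+1}·C_D)·K261…`) depends on `d, L, b₀, b₁, α, N₀, σ, C_D, c_D` — print: *"O(1)
depending on d and L only"* for fixed `α`; uniform in `k, M_h, c′` (the point of Prop. 2.6).  (3) Entries `|(G∇*J)(x)|`, `|(ΔGJ)(x)|` and (2.137)–(2.140)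
untouched (the `Δ` entry is one more instance of the left-factor clause).  Integer torus, lattice units; nothing on d = 4 specifically or the continuum;
NOT summit progress.  Unit `lit-balaban-p38` (gen 30), 2026-08-23.
-/

open scoped BigOperators
open Finset

namespace Literature.MathematicalPhysics.QuantumFieldTheory.Balaban1983to89.B6Prop26GradKLevelV1

open B4Reflection242 (boxDom)
open B6MultiLevelBoxOperator (N0)
open B6MultiLevelTorusOperator (TDomains)
open B6Cover236MultiLevelBlocks (cubes)
open B6Geom246MultiLevelTorus (geomT)
open B8Ineq192MultiLevelTorus (geomTB geomT_len)
open B6RandomWalk (HasMajorant hasMajorant_mono delta3)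
open B6Prop26Gluing (mulOp ind ind_nonneg)
open B6Ineq2133TwoScaleV1 (onFun)
open B6GlobalChartV1 (PV domT blkV1)
open B6SectAOperatorsV1 (dE dsE RE BondIdx)
open B6SectAVectorModelV1 (GE)
open B6Ineq261LevelGap (K261 K261_nonneg)
open B6Prop26KLevelSkeletonV1 (hB zB ST pref pref_nonneg)
open B6Prop26KLevelSkeletonV2 (SbigT ST_subset_SbigT)
open B6CubeWindowV1 (Placed Gl Pl GlobalBand placed_all_cubes band_le one_le_of_eight_le four_le_of_five_le)
open B6CubeCoeffSizesV1 (abs_cfC_le cfC_supp abs_c0C_le c0C_supp s1C_nonneg s2C_nonneg)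
open B6CubeMoutV1 (outLoc_Ml_hB')
open B6Cover236QbigOverlapV1 (card_filter_mem_QbigT_le)
open B6Prop26KLevelAssemblyV1 (distT_nonneg)
open B6Prop26LeftEntryKLevelV1 (ind_mono)
open B6Prop26PairKLevelAssemblyV1 (prop26_pair_kLevel_assembly_le)
open B6GradLegKLevelV1 (DV hDG0_cube)
open B6PadLevelV1 (padT SameOm hN_pad N0_pad placed_pad sameOm_domT_pad eT dist_eT pref_eT hasMajorant_of_pad globalBand_pad)
open B6Prop26KLevelAssemblyPadV1 (hLP_of_V1 hP5_of_V1 hk'_of_V1)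
open B6Line3CubeV1 (line3_cube)

noncomputable section

/-- monotonicity of the exponential in the rate. [folklore] -/
private theorem exp_le_exp_of_rate {ρ σ t : ℝ} (h : σ ≤ ρ) (ht : 0 ≤ t) : Real.exp (-(ρ * t)) ≤ Real.exp (-(σ * t)) :=
  Real.exp_le_exp.mpr (neg_le_neg (mul_le_mul_of_nonneg_right h ht))

/-! ## §1  (2.136)₁ ∧ (2.136)₂ for the genuine k-level `G`, only line 3 displayed, at any rate `σ ≤ σ₀` -/

section Grad

open Classical in
/-- **PROPOSITION 2.6, ENTRIES (2.136)₁ AND (2.136)₂, FOR THE GENUINE k-LEVEL `G = Δ_a⁻¹` ON THE V1 TORUS — ONLY LINE 3 DISPLAYED, ANY RATE `σ ≤ σ₀`.**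
Binders = those of p38's `…PerCube.prop26_2136_kLevel_assembly_line3` with the rate a parameter (as r03's `prop26_2136_kLevel_final_le`); conclusion = the
(2.136)₁ majorant of `onFun G` ∧ for every direction `ν` the (2.136)₂ majorant `A·(L^{j(y)}·|c′|⁻¹)·e^{−δ₃d_T}` of `DV ν c′ ∘ₗ onFun G` (r05's slot 2 with
`Dop ν := DV ν c′`), same `A`, `δ₃ = delta3 α (2σ)`.
[cite: Balaban1984PropagatorsII, Prop. 2.6 (2.136) p.247 («|(∇GJ)(x)| ≤ O(1)Lʲηe^{−δ₃d(y,y′)}|J|»), (2.141) p.247, (2.133)–(2.135) p.247, (2.92) p.239, (2.36) p.229, Lemma 2.1 p.234] -/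
theorem prop26_2136_grad_kLevel_line3_le (d ℓ : ℕ) (hd : 1 ≤ d + 1) (hL : Odd (ℓ + 1) ∧ 1 < ℓ + 1) {b₀ b₁ : ℝ} (hb₀ : 0 < b₀) (hb₁ : b₀ ≤ b₁) :
    ∃ σ₀ : ℝ, 0 < σ₀ ∧ ∀ (σ : ℝ), 0 < σ → σ ≤ σ₀ → ∀ (α : ℝ), 0 ≤ α → α ≤ 1 → ∀ (N₀ : ℕ), 0 < N₀ → ∀ {CD cD : ℝ}, 0 ≤ CD → 0 < cD →
    ∃ A M₁ : ℝ, 0 ≤ A ∧ 0 < M₁ ∧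
    ∀ (m K : ℕ) {Mh k R : ℕ} {P' : Fin (d + 1) → ℕ}
      (hN : ∀ μ, N0 ℓ Mh k P' μ = (PV d ℓ m K hd hL).sitesPerDir 0) (D : TDomains d ℓ Mh k P' R) (hk : k ≤ m + K) (_ : 2 ≤ k)
      {a : ℕ} (hMha : Mh = (ℓ + 1) ^ a) (hM8 : 8 ≤ Mh) (_ : 2 * (ℓ + 1) ^ 2 ≤ R) (hP5 : ∀ μ, 5 ≤ P' μ) (_ : 4 ≤ ℓ)
      (hpl : ∀ c : ↥(cubes D.toDomains), Placed ℓ k P' c.1)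
      (_ : M₁ ≤ ((ℓ : ℝ) + 1) * Mh) (_ : N₀ + 1 ≤ R * ((ℓ + 1) * Mh))
      (_ : Real.exp (-(α * σ)) * ((ℓ : ℝ) + 1) ^ ((2 * (d + 1 : ℕ) : ℝ) / N₀) < 1)
      {cf : ℝ} (hcf : cf ≠ 0) {w : BondIdx (domT hN D hk) → ℝ} (hw : ∀ i, 0 < w i) (_ : GlobalBand b₀ b₁ cf w)
      -- line 3 (r03 g22 / p22), the only per-cube input left
      (_ : ∀ c : ↥(cubes D.toDomains), HasMajorant (g := geomTB D) (blkV1 hN D)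
        (mulOp (zB hN D (one_le_of_eight_le hM8) (four_le_of_five_le hP5) c) *
          (onFun (dE (P := PV d ℓ m K hd hL) cf ∘ₗ (LinearMap.id - RE (domT hN D hk) cf) ∘ₗ dsE cf) -
            Pl hN hk (one_le_of_eight_le hM8) (four_le_of_five_le hP5) hMha c (band_le (d := d) (ℓ := ℓ) hb₀ hb₁) (hpl c) w cf) *
          mulOp (hB hN D c))
        (fun y y'' => CD * cf ^ 2 * Real.exp (-(cD * (geomTB D).M)) / (geomTB D).len y ^ 2 * Real.exp (-((2 * σ) * (geomTB D).dist y y'')))),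
      HasMajorant (g := geomT D) (blkV1 hN D) (onFun (GE (domT hN D hk) hcf hw))
        (fun y y' => A * pref cf y * Real.exp (-(delta3 α (2 * σ) * (geomT D).dist y y'))) ∧
      ∀ ν : Fin (d + 1), HasMajorant (g := geomT D) (blkV1 hN D) (DV ν cf ∘ₗ onFun (GE (domT hN D hk) hcf hw))
        (fun y y' => A * ((geomT D).len y * |cf|⁻¹) * Real.exp (-(delta3 α (2 * σ) * (geomT D).dist y y'))) := by
  have ha₀ : (0 : ℝ) < b₀ / ((ℓ + 1 : ℕ) : ℝ) := by positivity
  obtain ⟨ρD, hρD, CD', hCD', hleg⟩ := hDG0_cube d ℓ hd hL ha₀ (band_le (d := d) (ℓ := ℓ) hb₀ hb₁)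
  obtain ⟨σ₀, hσ₀, h⟩ := prop26_pair_kLevel_assembly_le d ℓ hd hL hb₀ hb₁
  refine ⟨min σ₀ ρD, lt_min hσ₀ hρD, fun σ hσ0 hσle α hα0 hα1 N₀ hN₀ CD cD hCD hcD => ?_⟩
  obtain ⟨A, M₁, hA, hM₁, h2⟩ := h σ hσ0 (hσle.trans (min_le_left _ _)) α hα0 hα1 N₀ hN₀ (3 * 9 ^ (d + 1)) (s1C_nonneg d ℓ) (s2C_nonneg d ℓ)
    hCD hcD
  refine ⟨max A (2 * ((((3 * 9 ^ (d + 1) : ℕ)) : ℝ) * CD') * K261 N₀ (d + 1) ((ℓ : ℝ) + 1) 1 (α * σ)), M₁, le_max_of_le_left hA, hM₁, ?_⟩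
  intro m K Mh k R P' hN D hk hk2 a hMha hM8 hR2 hP5 hℓ hpl hLM hRM hθ cf hcf w hw hwb hD3
  obtain ⟨h1, hclause⟩ := h2 m K hN D hk hk2 hMha hM8 hR2 hP5 hℓ hpl hLM hRM hθ hcf hw hwb
    (card_filter_mem_QbigT_le D hL (le_trans (by norm_num) hM8) hR2 (one_le_of_eight_le hM8) (four_le_of_five_le hP5))
    (fun c => outLoc_Ml_hB' hN hk (one_le_of_eight_le hM8) (four_le_of_five_le hP5) hMha c (band_le (d := d) (ℓ := ℓ) hb₀ hb₁)
      hM8 hR2 hP5 (hpl c) w cf)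
    (fun c e x => abs_cfC_le hN hk (one_le_of_eight_le hM8) (four_le_of_five_le hP5) hMha c (band_le (d := d) (ℓ := ℓ) hb₀ hb₁)
      hM8 hR2 hP5 (hpl c) w cf e x)
    (fun c e x hx => cfC_supp hN hk (one_le_of_eight_le hM8) (four_le_of_five_le hP5) hMha c (band_le (d := d) (ℓ := ℓ) hb₀ hb₁)
      hM8 hR2 hP5 (hpl c) w cf e x hx)
    (fun c x => abs_c0C_le hN hk (one_le_of_eight_le hM8) (four_le_of_five_le hP5) hMha c (band_le (d := d) (ℓ := ℓ) hb₀ hb₁)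
      hM8 hR2 hP5 (hpl c) w cf x)
    (fun c x hx => c0C_supp hN hk (one_le_of_eight_le hM8) (four_le_of_five_le hP5) hMha c (band_le (d := d) (ℓ := ℓ) hb₀ hb₁)
      hM8 hR2 hP5 (hpl c) w cf x hx)
    hD3
  have hdnn : ∀ y y' : (geomT D).Site, 0 ≤ (geomT D).dist y y' := distT_nonneg
  refine ⟨hasMajorant_mono _ h1 fun y y' => ?_, fun ν => ?_⟩
  · have := pref_nonneg cf y
    exact mul_le_mul_of_nonneg_right (mul_le_mul_of_nonneg_right (le_max_left _ _) this) (Real.exp_nonneg _)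
  · -- the first legs of the cubes at rate `σ ≤ ρ_D`, output indicator `□̃ ⊇ □⁺`
    have hlen0 : ∀ y : (geomT D).Site, 0 ≤ (geomT D).len y * |cf|⁻¹ := fun y => by rw [geomT_len]; positivity
    have hD : ∀ c : ↥(cubes D.toDomains), HasMajorant (g := geomT D) (blkV1 hN D)
        (DV ν cf * (mulOp (hB hN D c) *
          Gl hN hk (one_le_of_eight_le hM8) (four_le_of_five_le hP5) hMha c (band_le (d := d) (ℓ := ℓ) hb₀ hb₁) (hpl c) w cf * mulOp (hB hN D c)))
        (fun y y' => ind (SbigT D (one_le_of_eight_le hM8) (four_le_of_five_le hP5) c) y *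
          (CD' * ((geomT D).len y * |cf|⁻¹) * Real.exp (-(σ * (geomT D).dist y y')))) := by
      intro c
      refine hasMajorant_mono _ (hleg m K hN D hk (one_le_of_eight_le hM8) (four_le_of_five_le hP5) hMha hM8 hR2 hP5 hℓ c (hpl c) w hcf ν)
        fun y y' => ?_
      have hl := hlen0 y
      exact mul_le_mul (ind_mono (ST_subset_SbigT D _ _ c) y)
        (mul_le_mul_of_nonneg_left (exp_le_exp_of_rate (hσle.trans (min_le_right _ _)) (hdnn y y')) (by positivity))
        (by positivity) (ind_nonneg _ _)
    have hres := hclause (DV ν cf) CD' (fun y => (geomT D).len y * |cf|⁻¹) hCD' hlen0 hD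
    have e : DV (P := PV d ℓ m K hd hL) ν cf ∘ₗ onFun (GE (domT hN D hk) hcf hw) = DV ν cf * onFun (GE (domT hN D hk) hcf hw) := rfl
    rw [e]
    refine hasMajorant_mono _ hres fun y y' => ?_
    have hl := hlen0 y
    exact mul_le_mul_of_nonneg_right (mul_le_mul_of_nonneg_right (le_max_right _ _) hl) (Real.exp_nonneg _)

end Grad

/-! ## §2  The same for EVERY odd `L ≥ 5` without the placement hypothesis: the padded family (p38 g29's `…B6PadLevelV1`) -/

section Pad

open Classical in
/-- **(2.136)₁ ∧ (2.136)₂ FOR THE GENUINE k-LEVEL `G`, EVERY ODD `L ≥ 5`, NO PLACEMENT HYPOTHESIS** — `prop26_2136_grad_kLevel_line3_le` applied to the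
padded family `padT D` (`k + 1` levels, empty bottom level, `P′ = L·P″`; every cube placed by `placed_pad`; the same `𝔅`, `R`, `Δ_a`, hence the same
`G` — `SameOm.GE_eq` — and the same blocks, distance and lengths — `hasMajorant_of_pad`, `dist_eT`, `pref_eT`): binders = those of
`…B6Prop26KLevelAssemblyPadV1.prop26_2136_kLevel_final_pad_le` verbatim (line 3 displayed for the cubes of the padded family, weights `w ∘ idxB`);
conclusion = the slot-1 majorant of `onFun G` ∧ for every `ν` the slot-2 majorant `A·(L^{j(y)}·|c′|⁻¹)·e^{−delta3 α (2σ)·d_T}` of `DV ν c′ ∘ₗ onFun G`.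
[cite: Balaban1984PropagatorsII, Prop. 2.6 (2.136) p.247, (2.141) p.247, (2.133)–(2.135) p.247, (2.92) p.239, (2.36) p.229, (2.1)–(2.4) p.224, Lemma 2.1 p.234] -/
theorem prop26_2136_grad_kLevel_pad_le (d ℓ : ℕ) (hd : 1 ≤ d + 1) (hL : Odd (ℓ + 1) ∧ 1 < ℓ + 1) {b₀ b₁ : ℝ} (hb₀ : 0 < b₀) (hb₁ : b₀ ≤ b₁) :
    ∃ σ₀ : ℝ, 0 < σ₀ ∧ ∀ (σ : ℝ), 0 < σ → σ ≤ σ₀ → ∀ (α : ℝ), 0 ≤ α → α ≤ 1 → ∀ (N₀ : ℕ), 0 < N₀ → ∀ {CD cD : ℝ}, 0 ≤ CD → 0 < cD →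
    ∃ A M₁ : ℝ, 0 ≤ A ∧ 0 < M₁ ∧
    ∀ (m K : ℕ) {Mh k R : ℕ} {P' P'' : Fin (d + 1) → ℕ}
      (hN : ∀ μ, N0 ℓ Mh k P' μ = (PV d ℓ m K hd hL).sitesPerDir 0) (D : TDomains d ℓ Mh k P' R) (hk : k ≤ m + K) (hk' : k + 1 ≤ m + K) (_ : 1 ≤ k)
      {a : ℕ} (hMha : Mh = (ℓ + 1) ^ a) (hM8 : 8 ≤ Mh) (_ : 2 * (ℓ + 1) ^ 2 ≤ R)
      (hLP : ∀ μ, P' μ = (ℓ + 1) * P'' μ) (hP5 : ∀ μ, 5 ≤ P'' μ) (_ : 4 ≤ ℓ)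
      (_ : M₁ ≤ ((ℓ : ℝ) + 1) * Mh) (_ : N₀ + 1 ≤ R * ((ℓ + 1) * Mh))
      (_ : Real.exp (-(α * σ)) * ((ℓ : ℝ) + 1) ^ ((2 * (d + 1 : ℕ) : ℝ) / N₀) < 1)
      {cf : ℝ} (hcf : cf ≠ 0) {w : BondIdx (domT hN D hk) → ℝ} (hw : ∀ i, 0 < w i) (_ : GlobalBand b₀ b₁ cf w)
      -- line 3 for the members of the cubes of the PADDED family (every cube placed: `placed_pad`)
      (_ : ∀ c : ↥(cubes (padT D hLP).toDomains), HasMajorant (g := geomTB (padT D hLP)) (blkV1 (hN_pad hN hLP) (padT D hLP))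
        (mulOp (zB (hN_pad hN hLP) (padT D hLP) (one_le_of_eight_le hM8) (four_le_of_five_le hP5) c) *
          (onFun (dE (P := PV d ℓ m K hd hL) cf ∘ₗ (LinearMap.id - RE (domT (hN_pad hN hLP) (padT D hLP) hk') cf) ∘ₗ dsE cf) -
            Pl (hN_pad hN hLP) hk' (one_le_of_eight_le hM8) (four_le_of_five_le hP5) hMha c (band_le (d := d) (ℓ := ℓ) hb₀ hb₁)
              (placed_pad D hLP hP5 c) (w ∘ (sameOm_domT_pad hN D hk hLP hk').idxB) cf) *
          mulOp (hB (hN_pad hN hLP) (padT D hLP) c))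
        (fun y y'' => CD * cf ^ 2 * Real.exp (-(cD * (geomTB (padT D hLP)).M)) / (geomTB (padT D hLP)).len y ^ 2 *
          Real.exp (-((2 * σ) * (geomTB (padT D hLP)).dist y y'')))),
      HasMajorant (g := geomT D) (blkV1 hN D) (onFun (GE (domT hN D hk) hcf hw))
        (fun y y' => A * pref cf y * Real.exp (-(delta3 α (2 * σ) * (geomT D).dist y y'))) ∧
      ∀ ν : Fin (d + 1), HasMajorant (g := geomT D) (blkV1 hN D) (DV ν cf ∘ₗ onFun (GE (domT hN D hk) hcf hw))
        (fun y y' => A * ((geomT D).len y * |cf|⁻¹) * Real.exp (-(delta3 α (2 * σ) * (geomT D).dist y y'))) := by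
  obtain ⟨σ₀, hσ₀, h⟩ := prop26_2136_grad_kLevel_line3_le d ℓ hd hL hb₀ hb₁
  refine ⟨σ₀, hσ₀, fun σ hσ0 hσle α hα0 hα1 N₀ hN₀ CD cD hCD hcD => ?_⟩
  obtain ⟨A, M₁, hA, hM₁, h2⟩ := h σ hσ0 hσle α hα0 hα1 N₀ hN₀ hCD hcD
  refine ⟨A, M₁, hA, hM₁, ?_⟩
  intro m K Mh k R P' P'' hN D hk hk' hk1 a hMha hM8 hR2 hLP hP5 hℓ hLM hRM hθ cf hcf w hw hwb hD3
  have hS := sameOm_domT_pad hN D hk hLP hk'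
  have hw' : ∀ i, 0 < (w ∘ hS.idxB) i := fun i => hw _
  -- the pair for the padded family (k + 1 levels, every cube placed)
  have hpad := h2 m K (hN_pad hN hLP) (padT D hLP) hk' (by omega) hMha hM8 hR2 hP5 hℓ (placed_pad D hLP hP5) hLM hRM hθ hcf hw'
    (globalBand_pad D hLP hN hk hk' hwb) hD3
  -- the padded family has literally the same `G`
  rw [hS.GE_eq hcf hw hw'] at hpad
  -- the same blocks, block map, distance, prefactor and lengths
  have hK : (fun a b : (geomT D).Site => A * pref cf (D := padT D hLP) (eT D hLP a) *
      Real.exp (-(delta3 α (2 * σ) * (geomT (padT D hLP)).dist (eT D hLP a) (eT D hLP b)))) =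
      fun y y' => A * pref cf y * Real.exp (-(delta3 α (2 * σ) * (geomT D).dist y y')) := by
    funext a b
    rw [dist_eT, pref_eT]
  have hK2 : (fun a b : (geomT D).Site => A * ((geomT (padT D hLP)).len (eT D hLP a) * |cf|⁻¹) *
      Real.exp (-(delta3 α (2 * σ) * (geomT (padT D hLP)).dist (eT D hLP a) (eT D hLP b)))) =
      fun y y' => A * ((geomT D).len y * |cf|⁻¹) * Real.exp (-(delta3 α (2 * σ) * (geomT D).dist y y')) := by
    funext a b
    rw [dist_eT]
    rfl
  refine ⟨?_, fun ν => ?_⟩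
  · rw [← hK]
    exact hasMajorant_of_pad D hLP hN hpad.1
  · rw [← hK2]
    exact hasMajorant_of_pad D hLP hN (hpad.2 ν)

open Classical in
/-- **THE SAME STATED ON THE ORIGINAL DATA** (`P″ := P′/L`, `P′ ≥ 5L`, `M_h = Lᵃ`; the padding data derived by `hLP_of_V1`, `hP5_of_V1`, `hk'_of_V1` of
`…B6Prop26KLevelAssemblyPadV1`): (2.136)₁ ∧ (2.136)₂ for the genuine `G`, every odd `L ≥ 5`, `k ≥ 1`, rate `delta3 α (2σ)`, any `σ ≤ σ₀`.
[cite: Balaban1984PropagatorsII, Prop. 2.6 (2.136) p.247, (2.141) p.247, (2.133)–(2.135) p.247, (2.92) p.239, (2.36) p.229, (2.1)–(2.4) p.224, Lemma 2.1 p.234] -/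
theorem prop26_2136_grad_kLevel_pad_le_V1 (d ℓ : ℕ) (hd : 1 ≤ d + 1) (hL : Odd (ℓ + 1) ∧ 1 < ℓ + 1) {b₀ b₁ : ℝ} (hb₀ : 0 < b₀) (hb₁ : b₀ ≤ b₁) :
    ∃ σ₀ : ℝ, 0 < σ₀ ∧ ∀ (σ : ℝ), 0 < σ → σ ≤ σ₀ → ∀ (α : ℝ), 0 ≤ α → α ≤ 1 → ∀ (N₀ : ℕ), 0 < N₀ → ∀ {CD cD : ℝ}, 0 ≤ CD → 0 < cD →
    ∃ A M₁ : ℝ, 0 ≤ A ∧ 0 < M₁ ∧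
    ∀ (m K : ℕ) {Mh k R : ℕ} {P' : Fin (d + 1) → ℕ}
      (hN : ∀ μ, N0 ℓ Mh k P' μ = (PV d ℓ m K hd hL).sitesPerDir 0) (D : TDomains d ℓ Mh k P' R) (hk : k ≤ m + K) (_ : 1 ≤ k)
      {a : ℕ} (hMha : Mh = (ℓ + 1) ^ a) (hM8 : 8 ≤ Mh) (_ : 2 * (ℓ + 1) ^ 2 ≤ R) (hP : ∀ μ, 5 * (ℓ + 1) ≤ P' μ) (_ : 4 ≤ ℓ)
      (_ : M₁ ≤ ((ℓ : ℝ) + 1) * Mh) (_ : N₀ + 1 ≤ R * ((ℓ + 1) * Mh))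
      (_ : Real.exp (-(α * σ)) * ((ℓ : ℝ) + 1) ^ ((2 * (d + 1 : ℕ) : ℝ) / N₀) < 1)
      {cf : ℝ} (hcf : cf ≠ 0) {w : BondIdx (domT hN D hk) → ℝ} (hw : ∀ i, 0 < w i) (_ : GlobalBand b₀ b₁ cf w)
      (_ : ∀ c : ↥(cubes (padT D (hLP_of_V1 hN hMha hP)).toDomains),
        HasMajorant (g := geomTB (padT D (hLP_of_V1 hN hMha hP))) (blkV1 (hN_pad hN (hLP_of_V1 hN hMha hP)) (padT D (hLP_of_V1 hN hMha hP)))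
        (mulOp (zB (hN_pad hN (hLP_of_V1 hN hMha hP)) (padT D (hLP_of_V1 hN hMha hP)) (one_le_of_eight_le hM8)
            (four_le_of_five_le (hP5_of_V1 hP)) c) *
          (onFun (dE (P := PV d ℓ m K hd hL) cf ∘ₗ
              (LinearMap.id - RE (domT (hN_pad hN (hLP_of_V1 hN hMha hP)) (padT D (hLP_of_V1 hN hMha hP)) (hk'_of_V1 hN hMha hP)) cf) ∘ₗ dsE cf) -
            Pl (hN_pad hN (hLP_of_V1 hN hMha hP)) (hk'_of_V1 hN hMha hP) (one_le_of_eight_le hM8) (four_le_of_five_le (hP5_of_V1 hP)) hMha c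
              (band_le (d := d) (ℓ := ℓ) hb₀ hb₁) (placed_pad D (hLP_of_V1 hN hMha hP) (hP5_of_V1 hP) c)
              (w ∘ (sameOm_domT_pad hN D hk (hLP_of_V1 hN hMha hP) (hk'_of_V1 hN hMha hP)).idxB) cf) *
          mulOp (hB (hN_pad hN (hLP_of_V1 hN hMha hP)) (padT D (hLP_of_V1 hN hMha hP)) c))
        (fun y y'' => CD * cf ^ 2 * Real.exp (-(cD * (geomTB (padT D (hLP_of_V1 hN hMha hP))).M)) /
          (geomTB (padT D (hLP_of_V1 hN hMha hP))).len y ^ 2 * Real.exp (-((2 * σ) * (geomTB (padT D (hLP_of_V1 hN hMha hP))).dist y y'')))),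
      HasMajorant (g := geomT D) (blkV1 hN D) (onFun (GE (domT hN D hk) hcf hw))
        (fun y y' => A * pref cf y * Real.exp (-(delta3 α (2 * σ) * (geomT D).dist y y'))) ∧
      ∀ ν : Fin (d + 1), HasMajorant (g := geomT D) (blkV1 hN D) (DV ν cf ∘ₗ onFun (GE (domT hN D hk) hcf hw))
        (fun y y' => A * ((geomT D).len y * |cf|⁻¹) * Real.exp (-(delta3 α (2 * σ) * (geomT D).dist y y'))) := by
  obtain ⟨σ₀, hσ₀, h⟩ := prop26_2136_grad_kLevel_pad_le d ℓ hd hL hb₀ hb₁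
  refine ⟨σ₀, hσ₀, fun σ hσ0 hσle α hα0 hα1 N₀ hN₀ CD cD hCD hcD => ?_⟩
  obtain ⟨A, M₁, hA, hM₁, h2⟩ := h σ hσ0 hσle α hα0 hα1 N₀ hN₀ hCD hcD
  refine ⟨A, M₁, hA, hM₁, ?_⟩
  intro m K Mh k R P' hN D hk hk1 a hMha hM8 hR2 hP hℓ hLM hRM hθ cf hcf w hw hwb hD3
  exact h2 m K hN D hk (hk'_of_V1 hN hMha hP) hk1 hMha hM8 hR2 (hLP_of_V1 hN hMha hP) (hP5_of_V1 hP) hℓ hLM hRM hθ hcf hw hwb hD3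

end Pad

/-! ## §3  NO DISPLAYED ANALYTIC HYPOTHESIS: line 3 fed by r03 g22's `line3_cube`, the Lemma-2.1 exponent chosen inside (`α > 0`) -/

section Unconditional

/-- the budget inequality `e^{−ασ}·L^{2(d+1)/N₀} < 1` for `N₀ := ⌈2(d+1)·log L/(ασ)⌉₊ + 1` (`α, σ > 0`); r03's private `budget_lt_one`, re-proved. [folklore] -/
private theorem budget_lt_one {d ℓ : ℕ} {α σ : ℝ} (hα : 0 < α) (hσ : 0 < σ) :
    Real.exp (-(α * σ)) * ((ℓ : ℝ) + 1) ^ ((2 * (d + 1 : ℕ) : ℝ) / (⌈2 * ((d : ℝ) + 1) * Real.log ((ℓ : ℝ) + 1) / (α * σ)⌉₊ + 1 : ℕ)) < 1 := by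
  have hL : (0 : ℝ) < (ℓ : ℝ) + 1 := by positivity
  have hlog : 0 ≤ Real.log ((ℓ : ℝ) + 1) := Real.log_nonneg (by linarith [(Nat.cast_nonneg ℓ : (0 : ℝ) ≤ ℓ)])
  have hN : 2 * ((d : ℝ) + 1) * Real.log ((ℓ : ℝ) + 1) / (α * σ) <
      ((⌈2 * ((d : ℝ) + 1) * Real.log ((ℓ : ℝ) + 1) / (α * σ)⌉₊ + 1 : ℕ) : ℝ) := by
    push_cast
    exact lt_of_le_of_lt (Nat.le_ceil _) (lt_add_one _)
  have hNpos : (0 : ℝ) < ((⌈2 * ((d : ℝ) + 1) * Real.log ((ℓ : ℝ) + 1) / (α * σ)⌉₊ + 1 : ℕ) : ℝ) := by positivity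
  have hασ : 0 < α * σ := mul_pos hα hσ
  have key : (2 * (d + 1 : ℕ) : ℝ) / (⌈2 * ((d : ℝ) + 1) * Real.log ((ℓ : ℝ) + 1) / (α * σ)⌉₊ + 1 : ℕ) * Real.log ((ℓ : ℝ) + 1) < α * σ := by
    rw [div_mul_eq_mul_div, div_lt_iff₀ hNpos]
    rw [div_lt_iff₀ hασ] at hN
    push_cast at hN ⊢
    nlinarith
  rw [Real.rpow_def_of_pos hL, ← Real.exp_add, Real.exp_lt_one_iff]
  nlinarith

/-- `N₀ + 1 ≤ R·(L·M_h)` from `N₀ + 1 ≤ L·M_h` (as reals) and `R ≥ 1`. [folklore] -/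
private theorem hRM_of_le {ℓ Mh R N : ℕ} (hR2 : 2 * (ℓ + 1) ^ 2 ≤ R) (h : ((N : ℕ) : ℝ) + 1 ≤ ((ℓ : ℝ) + 1) * Mh) : N + 1 ≤ R * ((ℓ + 1) * Mh) := by
  have hR1 : 1 ≤ R := le_trans (by have := pow_pos (show 0 < ℓ + 1 by omega) 2; omega : 1 ≤ 2 * (ℓ + 1) ^ 2) hR2
  have h2 : N + 1 ≤ (ℓ + 1) * Mh := by exact_mod_cast h
  calc N + 1 ≤ (ℓ + 1) * Mh := h2
    _ = 1 * ((ℓ + 1) * Mh) := (one_mul _).symm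
    _ ≤ R * ((ℓ + 1) * Mh) := Nat.mul_le_mul_right _ hR1

open Classical in
/-- **PROPOSITION 2.6, ENTRIES (2.136)₁ AND (2.136)₂, AT k LEVELS FOR THE GENUINE `G = Δ_a⁻¹` OF THE V1 TORUS — NO DISPLAYED ANALYTIC HYPOTHESIS**
(the slot-2 twin of r03 g22's `…B6Line3CubeV1.prop26_2136_kLevel_unconditional`, SAME binders: line 3 of (2.92) for the cube member fed by
`line3_cube`, the Lemma-2.1 exponent chosen inside, rate `σ ≤ min(σ₀, ρ₃/2)`): for every weight band `[b₀, b₁]` there is `σ₁ > 0` such that for all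
`0 < σ ≤ σ₁`, `0 < α ≤ 1` there are `A ≥ 0`, `M₂ > 0` with: on every V1 global torus with `k ≥ 2`, `M_h = Lᵃ ≥ 8`, `M₂ ≤ L·M_h`, `R ≥ 2L²`, `P′ ≥ 5`,
`L ≥ 5`, all cubes placed, weights in the band, BOTH `|G(x, x′)| ≤ A·(L^{j(y)}/c′)²·e^{−δ₃ d_T(y,y′)}` AND, for every direction `ν`,
`|(∇^η_νG)(x, x′)| ≤ A·(L^{j(y)}·|c′|⁻¹)·e^{−δ₃ d_T(y,y′)}` blockwise (`δ₃ = delta3 α (2σ)`).  The remaining hypotheses are print's SETTING ((2.2), (2.16),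
the V1 torus, the placement of the top cubes — removed in `…_pad_V1` below), not analytic inputs.
[cite: Balaban1984PropagatorsII, Prop. 2.6 (2.136) p.247 («|(GJ)(x)|, |(∇GJ)(x)| ≤ O(1)[(Lʲη)², Lʲη]e^{−δ₃d(y,y′)}|J|»), (2.141) p.247, (2.92) p.239, Lemma 2.1 p.234] -/
theorem prop26_2136_grad_kLevel_unconditional (d ℓ : ℕ) (hd : 1 ≤ d + 1) (hL : Odd (ℓ + 1) ∧ 1 < ℓ + 1) {b₀ b₁ : ℝ} (hb₀ : 0 < b₀)
    (hb₁ : b₀ ≤ b₁) :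
    ∃ σ₁ : ℝ, 0 < σ₁ ∧ ∀ (σ : ℝ), 0 < σ → σ ≤ σ₁ → ∀ (α : ℝ), 0 < α → α ≤ 1 →
    ∃ A M₂ : ℝ, 0 ≤ A ∧ 0 < M₂ ∧
    ∀ (m K : ℕ) {Mh k R : ℕ} {P' : Fin (d + 1) → ℕ}
      (hN : ∀ μ, N0 ℓ Mh k P' μ = (PV d ℓ m K hd hL).sitesPerDir 0) (D : TDomains d ℓ Mh k P' R) (hk : k ≤ m + K) (_ : 2 ≤ k)
      {a : ℕ} (_ : Mh = (ℓ + 1) ^ a) (_ : 8 ≤ Mh) (_ : 2 * (ℓ + 1) ^ 2 ≤ R) (_ : ∀ μ, 5 ≤ P' μ) (_ : 4 ≤ ℓ)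
      (_ : ∀ c : ↥(cubes D.toDomains), Placed ℓ k P' c.1) (_ : M₂ ≤ ((ℓ : ℝ) + 1) * Mh)
      {cf : ℝ} (hcf : cf ≠ 0) {w : BondIdx (domT hN D hk) → ℝ} (hw : ∀ i, 0 < w i) (_ : GlobalBand b₀ b₁ cf w),
      HasMajorant (g := geomT D) (blkV1 hN D) (onFun (GE (domT hN D hk) hcf hw))
        (fun y y' => A * pref cf y * Real.exp (-(delta3 α (2 * σ) * (geomT D).dist y y'))) ∧
      ∀ ν : Fin (d + 1), HasMajorant (g := geomT D) (blkV1 hN D) (DV ν cf ∘ₗ onFun (GE (domT hN D hk) hcf hw))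
        (fun y y' => A * ((geomT D).len y * |cf|⁻¹) * Real.exp (-(delta3 α (2 * σ) * (geomT D).dist y y'))) := by
  obtain ⟨ρ₃, CD, cD, M₃, hρ₃, hCD, hcD, hcube⟩ := line3_cube d ℓ hd hL hb₀ hb₁
  obtain ⟨σ₀, hσ₀, h⟩ := prop26_2136_grad_kLevel_line3_le d ℓ hd hL hb₀ hb₁
  refine ⟨min σ₀ (ρ₃ / 2), lt_min hσ₀ (by linarith), fun σ hσ hσ1 α hα hα1 => ?_⟩
  obtain ⟨A, M₁, hA, hM₁, h2⟩ := h σ hσ (hσ1.trans (min_le_left _ _)) α hα.le hα1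
    (⌈2 * ((d : ℝ) + 1) * Real.log ((ℓ : ℝ) + 1) / (α * σ)⌉₊ + 1) (Nat.succ_pos _) hCD hcD
  refine ⟨A, max (max M₁ M₃) (((⌈2 * ((d : ℝ) + 1) * Real.log ((ℓ : ℝ) + 1) / (α * σ)⌉₊ + 1 : ℕ) : ℝ) + 1), hA,
    lt_max_of_lt_left (lt_max_of_lt_left hM₁), ?_⟩
  intro m K Mh k R P' hN D hk hk2 a hMha hM8 hR2 hP5 hℓ hpl hM cf hcf w hw hwb
  have hσρ : 2 * σ ≤ ρ₃ := by linarith [hσ1.trans (min_le_right _ _)]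
  refine h2 m K hN D hk hk2 hMha hM8 hR2 hP5 hℓ hpl (((le_max_left _ _).trans (le_max_left _ _)).trans hM)
    (hRM_of_le hR2 ((le_max_right _ _).trans hM)) (budget_lt_one hα hσ) hcf hw hwb fun c => ?_
  refine hasMajorant_mono (g := geomTB D) (blkV1 hN D)
    (hcube m K hN D hk hk2 hMha hM8 hR2 hP5 hℓ hpl (((le_max_right _ _).trans (le_max_left _ _)).trans hM) hcf w c) ?_
  intro y y''
  have hd0 : 0 ≤ (geomTB D).dist y y'' := Nat.cast_nonneg _
  refine mul_le_mul_of_nonneg_left (Real.exp_le_exp.2 (by nlinarith)) ?_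
  have := B6Prop26KLevelAssemblyV1.lenTB_pos (D := D) y
  positivity

open Classical in
/-- **THE SAME FOR EVERY ODD `L ≥ 5`, `k ≥ 1`, NO PLACEMENT HYPOTHESIS** (`P′ ≥ 5L`; the padded family `padT D` of `…B6PadLevelV1` places every cube and
has the same `G`; `line3_cube` is fed AT THE PADDED FAMILY): hypotheses = the V1 torus (`hN`, `D`, `hk`, `k ≥ 1`, `M_h = Lᵃ ≥ 8`, `R ≥ 2L²`, `P′ ≥ 5L`,
`L ≥ 5`), one threshold `M₂ ≤ L·M_h`, `c′ ≠ 0`, the weight band — NOTHING per cube; conclusion: (2.136)₁ ∧ (2.136)₂ for the genuine `G`.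
[cite: Balaban1984PropagatorsII, Prop. 2.6 (2.136) p.247, (2.141) p.247, (2.92) p.239, (2.1)–(2.4) p.224, Lemma 2.1 p.234] -/
theorem prop26_2136_grad_kLevel_unconditional_pad_V1 (d ℓ : ℕ) (hd : 1 ≤ d + 1) (hL : Odd (ℓ + 1) ∧ 1 < ℓ + 1) {b₀ b₁ : ℝ} (hb₀ : 0 < b₀)
    (hb₁ : b₀ ≤ b₁) :
    ∃ σ₁ : ℝ, 0 < σ₁ ∧ ∀ (σ : ℝ), 0 < σ → σ ≤ σ₁ → ∀ (α : ℝ), 0 < α → α ≤ 1 →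
    ∃ A M₂ : ℝ, 0 ≤ A ∧ 0 < M₂ ∧
    ∀ (m K : ℕ) {Mh k R : ℕ} {P' : Fin (d + 1) → ℕ}
      (hN : ∀ μ, N0 ℓ Mh k P' μ = (PV d ℓ m K hd hL).sitesPerDir 0) (D : TDomains d ℓ Mh k P' R) (hk : k ≤ m + K) (_ : 1 ≤ k)
      {a : ℕ} (_ : Mh = (ℓ + 1) ^ a) (_ : 8 ≤ Mh) (_ : 2 * (ℓ + 1) ^ 2 ≤ R) (_ : ∀ μ, 5 * (ℓ + 1) ≤ P' μ) (_ : 4 ≤ ℓ)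
      (_ : M₂ ≤ ((ℓ : ℝ) + 1) * Mh)
      {cf : ℝ} (hcf : cf ≠ 0) {w : BondIdx (domT hN D hk) → ℝ} (hw : ∀ i, 0 < w i) (_ : GlobalBand b₀ b₁ cf w),
      HasMajorant (g := geomT D) (blkV1 hN D) (onFun (GE (domT hN D hk) hcf hw))
        (fun y y' => A * pref cf y * Real.exp (-(delta3 α (2 * σ) * (geomT D).dist y y'))) ∧
      ∀ ν : Fin (d + 1), HasMajorant (g := geomT D) (blkV1 hN D) (DV ν cf ∘ₗ onFun (GE (domT hN D hk) hcf hw))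
        (fun y y' => A * ((geomT D).len y * |cf|⁻¹) * Real.exp (-(delta3 α (2 * σ) * (geomT D).dist y y'))) := by
  obtain ⟨ρ₃, CD, cD, M₃, hρ₃, hCD, hcD, hcube⟩ := line3_cube d ℓ hd hL hb₀ hb₁
  obtain ⟨σ₀, hσ₀, h⟩ := prop26_2136_grad_kLevel_pad_le_V1 d ℓ hd hL hb₀ hb₁
  refine ⟨min σ₀ (ρ₃ / 2), lt_min hσ₀ (by linarith), fun σ hσ hσ1 α hα hα1 => ?_⟩
  obtain ⟨A, M₁, hA, hM₁, h2⟩ := h σ hσ (hσ1.trans (min_le_left _ _)) α hα.le hα1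
    (⌈2 * ((d : ℝ) + 1) * Real.log ((ℓ : ℝ) + 1) / (α * σ)⌉₊ + 1) (Nat.succ_pos _) hCD hcD
  refine ⟨A, max (max M₁ M₃) (((⌈2 * ((d : ℝ) + 1) * Real.log ((ℓ : ℝ) + 1) / (α * σ)⌉₊ + 1 : ℕ) : ℝ) + 1), hA,
    lt_max_of_lt_left (lt_max_of_lt_left hM₁), ?_⟩
  intro m K Mh k R P' hN D hk hk1 a hMha hM8 hR2 hP hℓ hM cf hcf w hw hwb
  have hσρ : 2 * σ ≤ ρ₃ := by linarith [hσ1.trans (min_le_right _ _)]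
  refine h2 m K hN D hk hk1 hMha hM8 hR2 hP hℓ (((le_max_left _ _).trans (le_max_left _ _)).trans hM)
    (hRM_of_le hR2 ((le_max_right _ _).trans hM)) (budget_lt_one hα hσ) hcf hw hwb fun c => ?_
  refine hasMajorant_mono (g := geomTB (padT D (hLP_of_V1 hN hMha hP))) (blkV1 (hN_pad hN (hLP_of_V1 hN hMha hP)) (padT D (hLP_of_V1 hN hMha hP)))
    (hcube m K (hN_pad hN (hLP_of_V1 hN hMha hP)) (padT D (hLP_of_V1 hN hMha hP)) (hk'_of_V1 hN hMha hP) (by omega) hMha hM8 hR2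
      (hP5_of_V1 hP) hℓ (placed_pad D (hLP_of_V1 hN hMha hP) (hP5_of_V1 hP)) (((le_max_right _ _).trans (le_max_left _ _)).trans hM) hcf
      (w ∘ (sameOm_domT_pad hN D hk (hLP_of_V1 hN hMha hP) (hk'_of_V1 hN hMha hP)).idxB) c) ?_
  intro y y''
  have hd0 : 0 ≤ (geomTB (padT D (hLP_of_V1 hN hMha hP))).dist y y'' := Nat.cast_nonneg _
  refine mul_le_mul_of_nonneg_left (Real.exp_le_exp.2 (by nlinarith)) ?_
  have := B6Prop26KLevelAssemblyV1.lenTB_pos (D := padT D (hLP_of_V1 hN hMha hP)) y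
  positivity

end Unconditional

end

end Literature.MathematicalPhysics.QuantumFieldTheory.Balaban1983to89.B6Prop26GradKLevelV1
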